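import Summits.Ventures.HodgeRepro2.T5SU11RadialGreenPositivity
import Summits.Ventures.HodgeRepro2.T5SU11RadialGreenSymmetric
import Summits.Ventures.HodgeRepro2.T5SU11ResolventDiagonalReflect
import Summits.Ventures.HodgeRepro2.T5SU11ResolventDiagonalEdge
import Summits.Ventures.HodgeRepro2.T5SU11HardyInequality
import Summits.Ventures.HodgeRepro2.T5SU11HardyRemainder

/-!
# Summary VIII — the spectral picture of the resolvent of the radial Laplacian (rows 461–482), under uniform names

The headline statements of rows 461–482 about the resolvent `G_λ = (L − λ(λ−2))⁻¹`, `λ > 1`, of the radial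
Laplacian `L = ∂² + 2 coth 2t ∂` of `SU(1,1)` on `L²((0, ∞), sinh 2t dt)` (built in rows 451–452 as the explicit
Green's operator `sphGreen lam f a b` for a continuous source `f` supported in `[a, b] ⊂ (0, ∞)`), re-exported:

* `resolvent_kernel_symm`, `resolvent_eq_integral_kernel` — `G_λ` is the integral operator with the symmetric
  kernel `−φ_λ(a_{min(t,s)}) χ_λ(max(t,s))` (row 461);
* `resolvent_nonpos` — `f ≥ 0 ⟹ G_λ f ≤ 0` (row 465);
* `resolvent_symm` — `⟨G_λ f, h⟩ = ⟨f, G_λ h⟩` (row 471);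
* `resolvent_diag` — the spherical transform diagonalises `G_λ`: `(G_λ f)^(λ′) = f̂(λ′)/(λ′(λ′−2) − λ(λ−2))` for
  `|λ′ − 1| < λ − 1`, `λ′ ≠ 1` (rows 470, 472), `resolvent_diag_edge` — the same at the bottom of the spectrum
  `λ′ = 1` with the multiplier `−1/(λ−1)²` (row 481), and `resolvent_diag_strip` — the two combined: the multiplier
  is `1/((λ′−1)² − (λ−1)²)` on the WHOLE strip `|λ′ − 1| < λ − 1`; `resolvent_diag_edge_abs` — the sharp bound
  `1/(λ−1)²` is attained on the ground state `Ξ = φ_1`;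
* `resolvent_energy` — `‖(G_λ f)′‖² + λ(λ−2)‖G_λ f‖² = −⟨f, G_λ f⟩` (row 475);
* `resolvent_hardy` — `‖G_λ f‖² ≤ ‖(G_λ f)′‖²` (row 478), `resolvent_inner_le` — `⟨f, G_λ f⟩ ≤ −(λ−1)²‖G_λ f‖²`,
  `resolvent_inner_nonpos` — the quadratic form is non-positive for every `λ > 1`, and
  `resolvent_bound_sharp` — `‖G_λ f‖² ≤ ‖f‖²/(λ−1)⁴`, i.e. `‖(L − λ(λ−2))⁻¹‖ ≤ 1/dist(λ(λ−2), (−∞, −1])` (row 478);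
* `hardy_compact_support` — `‖u‖² ≤ ‖u′‖²` for compactly supported `C¹` functions (row 479),
  `hardy_identity_compact_support` — the ground-state identity `‖u′‖² − ‖u‖² = ∫ sinh 2t Ξ² ((u/Ξ)′)²` with its
  non-negative remainder `hardy_remainder_nonneg` (row 482).

Nothing is claimed about (N).

Blind lane: Mathlib + the HodgeRepro2 prefix only; no sorry; axioms ⊆ {propext, Classical.choice,
Quot.sound}.
-/

namespace Summit.Ventures.HodgeRepro2.T5SU11RadialSummaryVIII

open MeasureTheory intervalIntegral
open Set (Ioi)
open T5SU11Cartan T5SU11SphericalFunction T5SU11SphericalGreen T5SU11SphericalDecay T5SU11RadialGreenKernel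
  T5SU11RadialGreenPositivity T5SU11RadialGreenSymmetric T5SU11ResolventDiagonal T5SU11ResolventDiagonalReflect
  T5SU11ResolventDiagonalEdge T5SU11ResolventEnergy T5SU11HardyInequality T5SU11HardyCompactSupport
  T5SU11HardyRemainder

/-- `λ′(λ′−2) − λ(λ−2) = (λ′−1)² − (λ−1)²`. -/
theorem mu_sub_mu_eq (lam lam' : ℝ) : lam' * (lam' - 2) - lam * (lam - 2) = (lam' - 1) ^ 2 - (lam - 1) ^ 2 := by
  ring

section measure

variable [MeasurableSpace Circle] [BorelSpace Circle]

/-! ### The kernel (rows 461, 465) -/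

omit [BorelSpace Circle] in
/-- **The Green's kernel is symmetric** (row 461). -/
theorem resolvent_kernel_symm (lam t s : ℝ) : sphGreenKernel lam t s = sphGreenKernel lam s t :=
  sphGreenKernel_symm lam t s

/-- **`G_λ f` is the integral operator with kernel `−φ_λ(a_{min}) χ_λ(max)`** on `[a, b]` (row 461). -/
theorem resolvent_eq_integral_kernel {lam a b : ℝ} {f : ℝ → ℝ} (hlam : 1 < lam) (hf : ContinuousOn f (Ioi 0))
    (ha : 0 < a) {t : ℝ} (hat : a ≤ t) (htb : t ≤ b) :
    sphGreen lam f a b t = ∫ s in a..b, sphGreenKernel lam t s * f s * Real.sinh (2 * s) :=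
  sphGreen_eq_integral_kernel hlam hf ha hat htb

/-- **The resolvent is a negative operator** (row 465): `f ≥ 0` supported in `[a, b]` ⟹ `G_λ f ≤ 0`. -/
theorem resolvent_nonpos {lam a b : ℝ} {f : ℝ → ℝ} (hlam : 1 < lam) (hf : ContinuousOn f (Ioi 0))
    (hf0 : ∀ t, 0 < t → 0 ≤ f t) (ha : 0 < a) (hab : a ≤ b) (hfa : ∀ s, s ≤ a → f s = 0)
    (hfb : ∀ s, b ≤ s → f s = 0) {t : ℝ} (ht : 0 < t) : sphGreen lam f a b t ≤ 0 :=
  sphGreen_nonpos hlam hf hf0 ha hab hfa hfb ht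

/-! ### Symmetry (row 471) -/

/-- **`⟨G_λ f, h⟩ = ⟨f, G_λ h⟩` in `L²((0, ∞), sinh 2t dt)`** (row 471). -/
theorem resolvent_symm {lam a b : ℝ} {f h : ℝ → ℝ} (hlam : 1 < lam) (hf : ContinuousOn f (Ioi 0))
    (hh : ContinuousOn h (Ioi 0)) (ha : 0 < a) (hab : a ≤ b) (hfa : ∀ s, s ≤ a → f s = 0)
    (hfb : ∀ s, b ≤ s → f s = 0) (hha : ∀ s, s ≤ a → h s = 0) (hhb : ∀ s, b ≤ s → h s = 0) :
    ∫ t in Ioi 0, sphGreen lam f a b t * h t * Real.sinh (2 * t)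
      = ∫ s in Ioi 0, f s * sphGreen lam h a b s * Real.sinh (2 * s) :=
  sphGreen_symm_Ioi hlam hf hh ha hab hfa hfb hha hhb

/-! ### The diagonalisation (rows 470, 472, 481) -/

variable {lam lam' a b : ℝ} {f : ℝ → ℝ} (hf : ContinuousOn f (Ioi 0))
  (ha : 0 < a) (hab : a ≤ b) (hfa : ∀ s, s ≤ a → f s = 0) (hfb : ∀ s, b ≤ s → f s = 0)

include hf ha hab hfa hfb in
/-- **The spherical transform diagonalises the resolvent** (rows 470, 472): for `|λ′ − 1| < λ − 1`, `λ′ ≠ 1`,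
`(G_λ f)^(λ′) = f̂(λ′)/(λ′(λ′−2) − λ(λ−2))`. -/
theorem resolvent_diag (h : |lam' - 1| < lam - 1) (hne : lam' ≠ 1) :
    ∫ t in Ioi 0, sphGreen lam f a b t * sph lam' (hyp t) * Real.sinh (2 * t)
      = (∫ t in Ioi 0, f t * sph lam' (hyp t) * Real.sinh (2 * t)) / (lam' * (lam' - 2) - lam * (lam - 2)) :=
  sphTransform_sphGreen_of_ne_one hf ha hab hfa hfb (abs_sub_one_lt_iff.1 h).1 (abs_sub_one_lt_iff.1 h).2 hne

include hf ha hab hfa hfb in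
/-- **The diagonalisation at the bottom of the spectrum** (row 481): `⟨G_λ f, Ξ⟩ = −⟨f, Ξ⟩/(λ−1)²`, `Ξ = φ_1`. -/
theorem resolvent_diag_edge (hlam : 1 < lam) :
    ∫ t in Ioi 0, sphGreen lam f a b t * sph 1 (hyp t) * Real.sinh (2 * t)
      = -(∫ t in Ioi 0, f t * sph 1 (hyp t) * Real.sinh (2 * t)) / (lam - 1) ^ 2 :=
  sphTransform_sphGreen_one hlam hf ha hab hfa hfb

include hf ha hab hfa hfb in
/-- **The diagonalisation on the whole strip `|λ′ − 1| < λ − 1`, edge included**: the resolvent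
`(L − λ(λ−2))⁻¹` acts on the spherical transform as multiplication by `1/((λ′−1)² − (λ−1)²)`. -/
theorem resolvent_diag_strip (h : |lam' - 1| < lam - 1) :
    ∫ t in Ioi 0, sphGreen lam f a b t * sph lam' (hyp t) * Real.sinh (2 * t)
      = (∫ t in Ioi 0, f t * sph lam' (hyp t) * Real.sinh (2 * t)) / ((lam' - 1) ^ 2 - (lam - 1) ^ 2) := by
  rcases eq_or_ne lam' 1 with rfl | hne
  · have hlam : 1 < lam := by
      have h0 : 0 ≤ |(1 : ℝ) - 1| := abs_nonneg _
      linarith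
    rw [resolvent_diag_edge hf ha hab hfa hfb hlam]
    have hne' : (lam - 1) ^ 2 ≠ 0 := by
      have : lam - 1 ≠ 0 := by linarith
      positivity
    field_simp
    ring
  · rw [resolvent_diag hf ha hab hfa hfb h hne, mu_sub_mu_eq]

include hf ha hab hfa hfb in
/-- **The sharp resolvent bound is attained on the ground state**: `|⟨G_λ f, Ξ⟩| = |⟨f, Ξ⟩|/(λ−1)²`. -/
theorem resolvent_diag_edge_abs (hlam : 1 < lam) :
    |∫ t in Ioi 0, sphGreen lam f a b t * sph 1 (hyp t) * Real.sinh (2 * t)|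
      = |∫ t in Ioi 0, f t * sph 1 (hyp t) * Real.sinh (2 * t)| / (lam - 1) ^ 2 := by
  rw [resolvent_diag_edge hf ha hab hfa hfb hlam, abs_div, abs_neg, abs_of_nonneg (sq_nonneg (lam - 1))]

/-! ### The energy identity, the Hardy inequality and the sharp bound (rows 475, 478) -/

include hf ha hab hfa hfb in
/-- **The energy identity** (row 475): `‖(G_λ f)′‖² + λ(λ−2)‖G_λ f‖² = −⟨f, G_λ f⟩` in `L²(sinh 2t dt)`. -/
theorem resolvent_energy (hlam : 1 < lam) :
    (∫ t in Ioi 0, Real.sinh (2 * t) * sphGreen' lam f a b t ^ 2)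
        + lam * (lam - 2) * (∫ t in Ioi 0, Real.sinh (2 * t) * sphGreen lam f a b t ^ 2)
      = -∫ t in a..b, Real.sinh (2 * t) * (f t * sphGreen lam f a b t) :=
  energy_identity hlam hf ha hab hfa hfb

include hf ha hab hfa hfb in
/-- **The Hardy inequality on the range of the resolvent** (row 478): `‖G_λ f‖² ≤ ‖(G_λ f)′‖²`. -/
theorem resolvent_hardy (hlam : 1 < lam) :
    ∫ t in Ioi 0, Real.sinh (2 * t) * sphGreen lam f a b t ^ 2
      ≤ ∫ t in Ioi 0, Real.sinh (2 * t) * sphGreen' lam f a b t ^ 2 :=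
  hardy_inequality hlam hf ha hab hfa hfb

include hf ha hab hfa hfb in
/-- **`⟨f, G_λ f⟩ ≤ −(λ−1)² ‖G_λ f‖²`** (row 478). -/
theorem resolvent_inner_le (hlam : 1 < lam) :
    ∫ t in a..b, f t * sphGreen lam f a b t * Real.sinh (2 * t)
      ≤ -((lam - 1) ^ 2 * ∫ t in Ioi 0, Real.sinh (2 * t) * sphGreen lam f a b t ^ 2) :=
  inner_sphGreen_le hlam hf ha hab hfa hfb

include hf ha hab hfa hfb in
/-- **The quadratic form of the resolvent is non-positive for every `λ > 1`** (row 478). -/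
theorem resolvent_inner_nonpos (hlam : 1 < lam) :
    ∫ t in a..b, f t * sphGreen lam f a b t * Real.sinh (2 * t) ≤ 0 :=
  inner_sphGreen_nonpos_of_one_lt hlam hf ha hab hfa hfb

include hf ha hab hfa hfb in
/-- **The sharp resolvent bound** (row 478): `‖G_λ f‖² ≤ ‖f‖²/(λ−1)⁴` in `L²(sinh 2t dt)` for every `λ > 1`,
i.e. `‖(L − λ(λ−2))⁻¹‖ ≤ 1/(λ−1)² = 1/dist(λ(λ−2), (−∞, −1])`. -/
theorem resolvent_bound_sharp (hlam : 1 < lam) :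
    ∫ t in Ioi 0, Real.sinh (2 * t) * sphGreen lam f a b t ^ 2
      ≤ (∫ t in Ioi 0, Real.sinh (2 * t) * f t ^ 2) / (lam - 1) ^ 4 :=
  integral_sinh_mul_sphGreen_sq_le_of_one_lt_Ioi hlam hf ha hab hfa hfb

/-! ### Hardy for compactly supported functions (rows 479, 482) -/

/-- **The Hardy inequality** (row 479): `‖u‖² ≤ ‖u′‖²` in `L²(sinh 2t dt)` for every `C¹` function `u` on `(0, ∞)`
with `u, u′` vanishing outside `[a, b] ⊂ (0, ∞)`. -/
theorem hardy_compact_support {u u' : ℝ → ℝ} (hu : ∀ t, 0 < t → HasDerivAt u (u' t) t)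
    (hcu' : ContinuousOn u' (Ioi 0)) {a b : ℝ} (ha : 0 < a) (hab : a ≤ b)
    (hua : ∀ t, t ≤ a → u t = 0) (hub : ∀ t, b ≤ t → u t = 0)
    (hu'a : ∀ t, t ≤ a → u' t = 0) (hu'b : ∀ t, b ≤ t → u' t = 0) :
    ∫ t in Ioi 0, Real.sinh (2 * t) * u t ^ 2 ≤ ∫ t in Ioi 0, Real.sinh (2 * t) * u' t ^ 2 :=
  hardy_inequality_of_support hu hcu' ha hab hua hub hu'a hu'b

/-- **The ground-state identity** (row 482): `‖u′‖² − ‖u‖² = ∫_a^b sinh 2t (u′Ξ − uΞ′)²/Ξ²`. -/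
theorem hardy_identity_compact_support {u u' : ℝ → ℝ} (hu : ∀ t, 0 < t → HasDerivAt u (u' t) t)
    (hcu' : ContinuousOn u' (Ioi 0)) {a b : ℝ} (ha : 0 < a) (hab : a ≤ b)
    (hua : ∀ t, t ≤ a → u t = 0) (hub : ∀ t, b ≤ t → u t = 0)
    (hu'a : ∀ t, t ≤ a → u' t = 0) (hu'b : ∀ t, b ≤ t → u' t = 0) :
    (∫ t in Ioi 0, Real.sinh (2 * t) * u' t ^ 2) - ∫ t in Ioi 0, Real.sinh (2 * t) * u t ^ 2
      = ∫ t in a..b, Real.sinh (2 * t) * (u' t * sph 1 (hyp t) - u t * deriv (fun t => sph 1 (hyp t)) t) ^ 2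
          / sph 1 (hyp t) ^ 2 :=
  hardy_identity_of_support hu hcu' ha hab hua hub hu'a hu'b

omit [BorelSpace Circle] in
/-- **The remainder is non-negative** (row 482). -/
theorem hardy_remainder_nonneg' {u u' : ℝ → ℝ} {a b : ℝ} (ha : 0 < a) (hab : a ≤ b) :
    0 ≤ ∫ t in a..b, Real.sinh (2 * t) * (u' t * sph 1 (hyp t) - u t * deriv (fun t => sph 1 (hyp t)) t) ^ 2
          / sph 1 (hyp t) ^ 2 :=
  hardy_remainder_nonneg ha hab

end measure

end Summit.Ventures.HodgeRepro2.T5SU11RadialSummaryVIII
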